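import Literature.IUT.HodgeTheaters.BadLocalFrobenioid
import Literature.IUT.HodgeTheaters.LocalFrobenioidsArch
import Mathlib.NumberTheory.Padics.ValuativeRel
import Mathlib.Analysis.Complex.Basic
import Mathlib.CategoryTheory.Discrete.Basic
import HarnessLib

/-!
# [IUTchI] Examples 3.2, 3.3, 3.4: non-vacuity of the local-Frobenioid INTERFACES (consistency witnesses)

Companion of `BadLocalFrobenioid.lean` (Ex. 3.2, `v ∈ V̲^bad`), `SplitFrobenioids.lean` (Ex. 3.3,
`v ∈ V̲^good ∩ V̲^non`) and `LocalFrobenioidsArch.lean` (Ex. 3.4, `v ∈ V̲^arc`) of abc-iut-L5-t2, kurims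
final manuscript (May 2020) pp. 69–82 [claim: Mochizuki2012, status: disputed]. Those files type the three
Examples as hypothesis structures `BadLocalFrobenioid l K_v`, `GoodLocalFrobenioid p K_v`,
`ArchLocalFrobenioid K_v` (≈ 40 / 25 / 15 fields each: categories, functors, adjunctions, equivalences,
monoid functors, splittings, real elements of `𝒪^▷_{K_v}`), over which [IUTchII]-side files quantify
universally (`ArchTriMuDatumBridge`, `HodgeTheaterKitBridge`, `LocalKummerDataBridge`, …). The cell's KIT
RULE (L5-lead 20:35Z: "hypothesis kits ship laws + inhabitant") asks for an explicit inhabitant, so that no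
universally quantified statement over these kits is vacuously true because of an inconsistent field
combination. THIS FILE gives the inhabitants:

* `BadLocalFrobenioid.trivial l K_v` — for EVERY `l` and EVERY valued field `K_v`: all categories the
  terminal category `Discrete PUnit`, all functors identities / constants, `q_v = q̲_v = 1`, all
  splittings `⊥`, the monoid `𝒪^▷_{C^Θ_v}` constant `PUnit`;
* `GoodLocalFrobenioid.trivial p` over `K_v := ℚ_p` (Mathlib's `ValuativeRel ℚ_[p]`; the one REAL field,
  `p_v ∈ 𝒪^▷_{K_v}`, holds because `|p|_p < 1`), divisor monoids constant `ℕ` generated by `log(p_v) := 1`;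
* `ArchLocalFrobenioid.trivial` over `K_v := ℂ`: `𝒜_{D_v} := ℂ`, `𝒪^▷(C_v) := 𝒪^▷_ℂ` (REAL), the
  Aut-holomorphic orbispace a point;
* `SplitTopMonoid.ofComplex` — the INTENDED object `(𝒪^▷_ℂ, (0,1])` of `TM⊢` (p. 81), whose splitting
  axiom "`C^× × C→ ⥲ C`" is the polar decomposition `z = (z/|z|)·|z|`, PROVED.

What this does NOT say: these toy inhabitants are not the objects of the text (which need the tempered
Frobenioids of [EtTh], the `p_v`-adic Frobenioids of [FrdII], Aut-holomorphic spaces of [AbsTopIII]); they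
only certify that the typed field combinations are jointly satisfiable. Nothing of the series is asserted.
-/

namespace Literature.IUT.HodgeTheaters

open CategoryTheory Literature.AlgebraicGeometry.Frobenioids

/-! ### The terminal category as carrier -/

namespace Witness

/-- The one-object one-morphism category used as every carrier below. [folklore] -/
abbrev Pt : Type := Discrete PUnit.{1}

/-- Its object. [folklore] -/
abbrev pt : Pt := ⟨PUnit.unit⟩

/-- Any two functors into the terminal category are isomorphic. [folklore] -/
def isoOfPt {C : Type} [Category.{0} C] (F G : C ⥤ Pt) : F ≅ G :=
  NatIso.ofComponents (fun _ => eqToIso (Subsingleton.elim _ _)) (fun _ => Subsingleton.elim _ _)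

/-- Morphisms in the slice `Pt/pt` are unique. [folklore] -/
instance subsingleton_over_hom (A B : Over pt) : Subsingleton (A ⟶ B) :=
  ⟨fun _ _ => Over.OverMorphism.ext (Subsingleton.elim _ _)⟩

/-- Automorphism groups in `Pt` are trivial. [folklore] -/
instance subsingleton_aut (X : Pt) : Subsingleton (Aut X) :=
  ⟨fun _ _ => Iso.ext (Subsingleton.elim _ _)⟩

/-- The constant functor `Pt ⥤ Pt/pt` at the identity arrow … [folklore] -/
def toOver : Pt ⥤ Over pt := (Functor.const Pt).obj (Over.mk (𝟙 pt))

/-- … is full (all hom-sets on both sides are singletons) … [folklore] -/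
instance toOver_full : toOver.Full where
  map_surjective {X Y} := fun f =>
    ⟨eqToHom (Subsingleton.elim X Y), Subsingleton.elim _ f⟩

/-- … and faithful. [folklore] -/
instance toOver_faithful : toOver.Faithful where
  map_injective {_ _} := fun _ _ _ => Subsingleton.elim _ _

/-- The constant monoid functor at the trivial monoid. [folklore] -/
abbrev unitMon (C : Type) [Category.{0} C] : Cᵒᵖ ⥤ CommMonCat.{0} :=
  (Functor.const Cᵒᵖ).obj (CommMonCat.of PUnit.{1})

/-- The constant monoid functor at `ℕ` (written multiplicatively). [folklore] -/
abbrev natMon (C : Type) [Category.{0} C] : Cᵒᵖ ⥤ CommMonCat.{0} :=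
  (Functor.const Cᵒᵖ).obj (CommMonCat.of (Multiplicative ℕ))

/-- The empty characteristic splitting (`τ_A := ⊥` for all `A`). [folklore] -/
def botSplitting (C : Type) [Category.{0} C] : S3Local.CharSplitting C := ⟨fun _ => ⊥⟩

/-- `⊥` is preserved by every functor. [folklore] -/
private theorem botSplitting_isPreservedBy {C C' : Type} [Category.{0} C] [Category.{0} C'] (Φ : C ⥤ C') :
    (botSplitting C).IsPreservedBy (botSplitting C') Φ :=
  fun _ => Submonoid.map_bot _

end Witness

open Witness

/-! ### Example 3.2: an inhabitant of `BadLocalFrobenioid l K_v` for every `l`, `K_v` -/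

/-- **Consistency witness for [IUTchI] Example 3.2 as typed** (`BadLocalFrobenioid`, pp. 69–73): for
every `l` and every valued field `K_v` the interface is inhabited — all carriers the terminal category, all
structure functors identities/constants (full, faithful, adjoint, equivalences as required),
`q_v := 1 =: q̲_v` (so `q̲_v^{2l} = q_v`), `Θ̲_v := id`, `l·ℤ := ⊥`, units `⊤`, all splittings `⊥`,
`𝒪^▷_{C^Θ_v} := PUnit`. A toy, not the tempered Frobenioid of [EtTh]. [claim: Mochizuki2012, status: disputed] -/
noncomputable def BadLocalFrobenioid.trivial (l : ℕ) (Kv : Type) [Field Kv] [ValuativeRel Kv] :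
    BadLocalFrobenioid.{0} l Kv where
  Dv := Pt
  Ddash := Pt
  incl := 𝟭 Pt
  proj := 𝟭 Pt
  adj := Adjunction.id
  Fv := Pt
  toBase := 𝟭 Pt
  T := id
  T_base A := Iso.refl A
  Fbirat := Pt
  birat := 𝟭 Pt
  biratBase := 𝟭 Pt
  birat_base := ⟨isoOfPt _ _⟩
  Ydd := pt
  unitsTY := ⊤
  unitsTY_comm _ _ _ _ := Subsingleton.elim _ _
  theta := Iso.refl _
  theta_mem := Subgroup.mem_top _
  lZ := ⊥
  Cv := Pt
  hull := 𝟭 Pt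
  q := 1
  qroot := 1
  qroot_pow := one_pow _
  Cdash := Pt
  CdashBase := 𝟭 Pt
  CdashToC := 𝟭 Pt
  CdashToC_base := ⟨isoOfPt _ _⟩
  tauDashOf _ := botSplitting Pt
  DTheta := Pt
  DThetaIncl := toOver
  prodEquiv := CategoryTheory.Equivalence.refl
  OTheta := unitMon Pt
  OThetaUnits _ := ⊤
  OThetaUnits_isUnit _ x :=
    ⟨fun _ => @isUnit_of_subsingleton _ _ (inferInstanceAs (Subsingleton PUnit.{1})) x,
      fun _ => Submonoid.mem_top _⟩
  OThetaOf _ := unitMon Pt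
  OThetaOf_theta := rfl
  CTheta := Pt
  CThetaBase := 𝟭 Pt
  CThetaToBirat := 𝟭 Pt
  CThetaToBirat_base := ⟨isoOfPt _ _⟩
  tauThetaOf _ := botSplitting Pt
  dashThetaEquiv := CategoryTheory.Equivalence.refl
  dashThetaEquiv_tau := botSplitting_isPreservedBy _
  dashThetaEquiv_base := ⟨isoOfPt _ _⟩

/-- `BadLocalFrobenioid l K_v` is inhabited for every `l` and every valued field `K_v`.
[claim: Mochizuki2012, status: disputed] -/
theorem BadLocalFrobenioid.nonempty (l : ℕ) (Kv : Type) [Field Kv] [ValuativeRel Kv] :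
    Nonempty (BadLocalFrobenioid.{0} l Kv) :=
  ⟨BadLocalFrobenioid.trivial l Kv⟩

/-! ### Example 3.3: an inhabitant of `GoodLocalFrobenioid p ℚ_p` -/

/-- The one REAL field of `GoodLocalFrobenioid p K_v`: `p_v ∈ 𝒪^▷_{K_v}` — for `K_v := ℚ_p` with Mathlib's
valuative structure, `|p|_p < 1` and `p ≠ 0`. [folklore] -/
private theorem Witness.padic_p_mem_intNonzero (p : ℕ) [Fact p.Prime] :
    ((p : ℚ_[p])) ∈ PadicFrd.intNonzero ℚ_[p] := by
  rw [PadicFrd.mem_intNonzero_iff]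
  exact ⟨(Padic.valuation_p_lt_one _).le, Nat.cast_ne_zero.mpr (Fact.out : p.Prime).ne_zero⟩

/-- In `Multiplicative ℕ` every element is a unique power of `ofAdd 1`. [folklore] -/
private theorem Witness.existsUnique_pow_ofAdd_one (x : Multiplicative ℕ) :
    ∃! n : ℕ, x = Multiplicative.ofAdd (1 : ℕ) ^ n := by
  refine ⟨Multiplicative.toAdd x, ?_, ?_⟩
  · change x = Multiplicative.ofAdd (Multiplicative.toAdd x • (1 : ℕ))
    rw [smul_eq_mul, mul_one]; rfl
  · intro n hn
    have := congrArg Multiplicative.toAdd hn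
    simpa using this.symm

/-- **Consistency witness for [IUTchI] Example 3.3 as typed** (`GoodLocalFrobenioid`, pp. 77–79) at
`K_v := ℚ_p`: carriers the terminal category, `Φ_{C_v} = Φ_{C⊢_v}` the constant monoid `ℕ` with
`log(p_v) := 1`, splittings `⊥`, `F⊢_v ⥲ F^Θ_v` the identity. A toy, not the `p_v`-adic Frobenioid of
[FrdII]. [claim: Mochizuki2012, status: disputed] -/
noncomputable def GoodLocalFrobenioid.trivial (p : ℕ) [Fact p.Prime] :
    GoodLocalFrobenioid.{0} p ℚ_[p] where
  Dv := Pt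
  Ddash := Pt
  incl := 𝟭 Pt
  proj := 𝟭 Pt
  adj := Adjunction.id
  PhiC := natMon Pt
  PhiCdash := natMon Pt
  PhiIncl := 𝟙 _
  PhiIncl_injective _ := fun _ _ h => h
  logp _ := Multiplicative.ofAdd (1 : ℕ)
  logp_generates _ x := Witness.existsUnique_pow_ofAdd_one x
  Cv := Pt
  toBase := 𝟭 Pt
  Cdash := Pt
  CdashBase := 𝟭 Pt
  CdashToC := 𝟭 Pt
  CdashToC_base := ⟨isoOfPt _ _⟩
  p_mem := Witness.padic_p_mem_intNonzero p
  tauDash := botSplitting Pt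
  CTheta := Pt
  CThetaBase := 𝟭 Pt
  tauTheta := botSplitting Pt
  dashThetaEquiv := CategoryTheory.Equivalence.refl
  dashThetaEquiv_tau := botSplitting_isPreservedBy _
  dashThetaEquiv_base := ⟨isoOfPt _ _⟩

/-- `GoodLocalFrobenioid p ℚ_p` is inhabited for every prime `p`. [claim: Mochizuki2012, status: disputed] -/
theorem GoodLocalFrobenioid.nonempty (p : ℕ) [Fact p.Prime] :
    Nonempty (GoodLocalFrobenioid.{0} p ℚ_[p]) :=
  ⟨GoodLocalFrobenioid.trivial p⟩

/-! ### Example 3.4: an inhabitant of `ArchLocalFrobenioid ℂ`; the object `(𝒪^▷_ℂ, (0,1])` of `TM⊢` -/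

/-- **Consistency witness for [IUTchI] Example 3.4 as typed** (`ArchLocalFrobenioid`, pp. 80–82) at
`K_v := ℂ`: `𝒜_{D_v} := ℂ` (a CAF, tautologically), `𝒪^▷(C_v) := 𝒪^▷_ℂ` with the identity
identifications (REAL), the Aut-holomorphic orbispace a point, `C_v = C^Θ_v` the terminal category. A toy
as far as `C_v`, `D_v` are concerned. [claim: Mochizuki2012, status: disputed] -/
noncomputable def ArchLocalFrobenioid.trivial : ArchLocalFrobenioid.{0} ℂ where
  Dv := { carrier := PUnit, autHol := ⊥ }
  Afield := ℂ
  caf := ⟨RingEquiv.refl ℂ, continuous_id, continuous_id⟩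
  Cv := Pt
  OC := unitDiscMonoid ℂ
  isoOK := MulEquiv.refl _
  isoOK_continuous := continuous_id
  isoOK_continuous_symm := continuous_id
  fieldIso := RingEquiv.refl ℂ
  fieldIso_continuous := continuous_id
  fieldIso_continuous_symm := continuous_id
  CTheta := Pt
  dashThetaEquiv := CategoryTheory.Equivalence.refl

/-- `ArchLocalFrobenioid ℂ` is inhabited. [claim: Mochizuki2012, status: disputed] -/
theorem ArchLocalFrobenioid.nonempty : Nonempty (ArchLocalFrobenioid.{0} ℂ) :=
  ⟨ArchLocalFrobenioid.trivial⟩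

namespace Witness

/-- A unit of the monoid `𝒪^▷_ℂ` has norm `1` (it and its inverse have norm `≤ 1`). [folklore] -/
private theorem norm_unit_eq_one (u : (unitDiscMonoid ℂ)ˣ) : ‖((u : unitDiscMonoid ℂ) : ℂ)‖ = 1 := by
  have h1 : ‖((u : unitDiscMonoid ℂ) : ℂ)‖ ≤ 1 := (u : unitDiscMonoid ℂ).2.2
  have h2 : ‖(((u⁻¹ : (unitDiscMonoid ℂ)ˣ) : unitDiscMonoid ℂ) : ℂ)‖ ≤ 1 :=
    ((u⁻¹ : (unitDiscMonoid ℂ)ˣ) : unitDiscMonoid ℂ).2.2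
  have hmul : ((u : unitDiscMonoid ℂ) : ℂ) * (((u⁻¹ : (unitDiscMonoid ℂ)ˣ) : unitDiscMonoid ℂ) : ℂ) = 1 := by
    have := congrArg (fun x : unitDiscMonoid ℂ => (x : ℂ)) (Units.mul_inv u)
    simpa only [Submonoid.coe_mul, Submonoid.coe_one] using this
  have hn : ‖((u : unitDiscMonoid ℂ) : ℂ)‖ * ‖(((u⁻¹ : (unitDiscMonoid ℂ)ˣ) : unitDiscMonoid ℂ) : ℂ)‖ = 1 := by
    rw [← norm_mul, hmul, norm_one]
  nlinarith [norm_nonneg ((u : unitDiscMonoid ℂ) : ℂ),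
    norm_nonneg ((((u⁻¹ : (unitDiscMonoid ℂ)ˣ) : unitDiscMonoid ℂ) : ℂ))]

/-- An element of `𝒪^▷_ℂ` of norm `1` is a unit of the monoid (inverse = conjugate = `z⁻¹`). [folklore] -/
noncomputable def unitOfNormOne (z : ℂ) (hz : ‖z‖ = 1) : (unitDiscMonoid ℂ)ˣ where
  val := ⟨z, by rw [← norm_ne_zero_iff, hz]; exact one_ne_zero, hz.le⟩
  inv := ⟨z⁻¹, inv_ne_zero (by rw [← norm_ne_zero_iff, hz]; exact one_ne_zero),
    by rw [norm_inv, hz, inv_one]⟩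
  val_inv := Subtype.ext (mul_inv_cancel₀ (by rw [← norm_ne_zero_iff, hz]; exact one_ne_zero))
  inv_val := Subtype.ext (inv_mul_cancel₀ (by rw [← norm_ne_zero_iff, hz]; exact one_ne_zero))

/-- The positive reals `(0, 1]` inside `𝒪^▷_ℂ` (the splitting `C→` of p. 81). [folklore] -/
noncomputable abbrev vecC : Submonoid (unitDiscMonoid ℂ) := (posRealMonoid ℂ).comap (unitDiscMonoid ℂ).subtype

/-- An element of `(0,1] ⊆ 𝒪^▷_ℂ` is the image of a real number in `(0,1]`, namely its norm. [folklore] -/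
private theorem coe_eq_norm_of_mem_vecC (r : unitDiscMonoid ℂ) (hr : r ∈ vecC) :
    ((r : ℂ)) = (‖(r : ℂ)‖ : ℂ) := by
  obtain ⟨s, hs, _, hs'⟩ := hr
  have : (r : ℂ) = (s : ℂ) := hs'
  rw [this, Complex.norm_real, Real.norm_of_nonneg hs.le]

/-- **Polar decomposition**: the product map `𝒪^×_ℂ × (0,1] → 𝒪^▷_ℂ` is a bijection — the splitting
axiom "`C^× × C→ ⥲ C`" of `TM⊢` for the intended object `𝒪^▷_ℂ` (p. 81: "the natural inclusions
`C^× ↪ C`, `C→ ↪ C` determine an isomorphism `C^× × C→ ⥲ C`") — PROVED. [claim: Mochizuki2012, status: disputed] -/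
theorem split_bijective :
    Function.Bijective (fun p : (unitDiscMonoid ℂ)ˣ × vecC =>
      ((p.1 : unitDiscMonoid ℂ) : unitDiscMonoid ℂ) * (p.2 : unitDiscMonoid ℂ)) := by
  constructor
  · rintro ⟨u₁, r₁⟩ ⟨u₂, r₂⟩ h
    have h' : ((u₁ : unitDiscMonoid ℂ) : ℂ) * ((r₁ : unitDiscMonoid ℂ) : ℂ) =
        ((u₂ : unitDiscMonoid ℂ) : ℂ) * ((r₂ : unitDiscMonoid ℂ) : ℂ) :=
      congrArg (fun x : unitDiscMonoid ℂ => (x : ℂ)) h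
    have hr₁ := coe_eq_norm_of_mem_vecC _ r₁.2
    have hr₂ := coe_eq_norm_of_mem_vecC _ r₂.2
    have hn : ‖((r₁ : unitDiscMonoid ℂ) : ℂ)‖ = ‖((r₂ : unitDiscMonoid ℂ) : ℂ)‖ := by
      have := congrArg (fun z : ℂ => ‖z‖) h'
      simp only [norm_mul, norm_unit_eq_one, one_mul] at this
      exact this
    have hr : ((r₁ : unitDiscMonoid ℂ) : ℂ) = ((r₂ : unitDiscMonoid ℂ) : ℂ) := by rw [hr₁, hr₂, hn]
    have hr0 : ((r₂ : unitDiscMonoid ℂ) : ℂ) ≠ 0 := (r₂ : unitDiscMonoid ℂ).2.1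
    have hu : ((u₁ : unitDiscMonoid ℂ) : ℂ) = ((u₂ : unitDiscMonoid ℂ) : ℂ) := by
      rw [hr] at h'
      exact mul_right_cancel₀ hr0 h'
    have hu' : u₁ = u₂ := Units.ext (Subtype.ext hu)
    have hr' : r₁ = r₂ := Subtype.ext (Subtype.ext hr)
    rw [hu', hr']
  · intro z
    have hz0 : (z : ℂ) ≠ 0 := z.2.1
    have hn0 : ‖(z : ℂ)‖ ≠ 0 := norm_ne_zero_iff.mpr hz0
    have hnpos : 0 < ‖(z : ℂ)‖ := norm_pos_iff.mpr hz0
    set u : ℂ := (z : ℂ) * (‖(z : ℂ)‖ : ℂ)⁻¹ with hu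
    have hun : ‖u‖ = 1 := by
      rw [hu, norm_mul, norm_inv, Complex.norm_real, Real.norm_of_nonneg (norm_nonneg _),
        mul_inv_cancel₀ hn0]
    let r : unitDiscMonoid ℂ := ⟨(‖(z : ℂ)‖ : ℂ), by exact_mod_cast hn0,
      by rw [Complex.norm_real, Real.norm_of_nonneg (norm_nonneg _)]; exact z.2.2⟩
    have hrv : r ∈ vecC := ⟨‖(z : ℂ)‖, hnpos, z.2.2, rfl⟩
    refine ⟨(unitOfNormOne u hun, ⟨r, hrv⟩), Subtype.ext ?_⟩
    change u * (‖(z : ℂ)‖ : ℂ) = (z : ℂ)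
    rw [hu, mul_assoc, inv_mul_cancel₀ (by exact_mod_cast hn0), mul_one]

end Witness

/-- **The intended object `(𝒪^▷_ℂ, (0, 1])` of `TM⊢`** (p. 81: "the CAFs `K_v`, `𝒜_{D_v}` determine, in a
natural way, objects of `TM⊢`"): `SplitTopMonoid` is inhabited by it, the splitting axiom being the polar
decomposition (`Witness.split_bijective`). [claim: Mochizuki2012, status: disputed] -/
noncomputable def SplitTopMonoid.ofComplex : SplitTopMonoid.{0} where
  C := unitDiscMonoid ℂ
  vec := Witness.vecC
  iso_unitDisc := ⟨MulEquiv.refl _, continuous_id, continuous_id⟩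
  split := Witness.split_bijective

/-- `TM⊢` is inhabited (by `(𝒪^▷_ℂ, (0,1])`). [claim: Mochizuki2012, status: disputed] -/
theorem SplitTopMonoid.nonempty : Nonempty SplitTopMonoid.{0} := ⟨SplitTopMonoid.ofComplex⟩

/-- For `X := ArchLocalFrobenioid.trivial`, the splitting `τ⊢_v` of Ex. 3.4 (ii) IS `(0,1] ⊆ 𝒪^▷_ℂ`
(definitional check that the typed `tauDash` is the intended one). [claim: Mochizuki2012, status: disputed] -/
theorem ArchLocalFrobenioid.trivial_tauDash :
    ArchLocalFrobenioid.trivial.tauDash = Witness.vecC := rfl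

end Literature.IUT.HodgeTheaters
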